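import Summits.QuantumFields.YangMills.Theses.LangevinControlUV
import Summits.QuantumFields.YangMills.Theorems.FemtoCurvatureTwoPoint.Negative.PlaquetteFreezing

/-!
# `FemtoCurvatureTwoPoint` — the crux with its LOWER bound deleted is a theorem
# (every compact `G`, every continuous unitary `ρ`): the lower bound is the unique content

Negative-side support lemma for crux `Summit.QuantumFields.YangMills.Theses.LangevinControlUV.
FemtoCurvatureTwoPoint` (item stmt-QuantumFields-9363; cdisprove gen 1, importable extract of
`§ UpperOnly` of the crux workfile
`Summits/QuantumFields/YangMills/Cruxes/FemtoCurvatureTwoPoint/Disproof.lean`).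

`exists_upperOnly`: for every compact second-countable `G` and continuous unitary `ρ` there are a
unit map `a > 0` with `a → 0` and a threshold `β₀` such that on every torus `(ℤ/L)⁴` with
`β ≥ β₀` and `L · a(β) ≤ 1` ALL rescaled plaquette covariances are `≤ 1`:
`n⁸ · Cov(P_0^{01}, P_{ne₂}^{01}) ≤ 1` (`1 ≤ n`, `8n ≤ L`) and
`|Cov(P_x^{ij}, P_y^{i'j'})| · dist(x,y)⁸ ≤ 1` (all `x, y, i, j, i', j'`). With `Γ ≡ 1`, `C = 1`,
`ℓ₀ = 1` this is the crux's conclusion verbatim MINUS the lower bound `c Γ(n a) ≤ n⁸ Cov` — so that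
lower bound is the unique load-bearing clause of the crux; everything else follows from freezing on
fixed tori (`Cov_{L,β} → 0` as `β → ∞`, `Negative.PlaquetteFreezing.tendsto_plaquetteCov`) and a
slowly decaying step
unit map built from the freezing thresholds — no ultraviolet input whatsoever.
-/

noncomputable section

open Filter Topology MeasureTheory
open Literature.MathematicalPhysics.QuantumFieldTheory Literature.MathematicalPhysics.QuantumLattice
open Summit.QuantumFields.YangMills.Theorems.TunedSequenceExists.Negative.Freezing
  (secondCountable_of_latticeRep)
open Summit.QuantumFields.YangMills.Theorems.FemtoCurvatureTwoPoint.Negative.PlaquetteFreezing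
  (tendsto_plaquetteCov)

namespace Summit.QuantumFields.YangMills.Theorems.FemtoCurvatureTwoPoint.Negative.UpperOnly

variable {G : Type} [Group G] [TopologicalSpace G] [IsTopologicalGroup G] [CompactSpace G]
  [MeasurableSpace G] [BorelSpace G] {N : ℕ} (ρ : G →* Matrix (Fin N) (Fin N) ℂ)

omit [Group G] [TopologicalSpace G] [IsTopologicalGroup G] [CompactSpace G] [MeasurableSpace G]
  [BorelSpace G] in
/-- Torus distances are at most the side: `dist(x, y) ≤ L`. -/
theorem torusDist_le_side {L : ℕ} [NeZero L] (x y : Site 4 L) :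
    Real.sqrt (∑ k : Fin 4, (((x k - y k).valMinAbs : ℤ) : ℝ) ^ 2) ≤ L := by
  rw [Real.sqrt_le_iff]
  refine ⟨by positivity, ?_⟩
  have hk : ∀ k : Fin 4, (((x k - y k).valMinAbs : ℤ) : ℝ) ^ 2 ≤ ((L : ℝ) / 2) ^ 2 := fun k => by
    have h1 : (((x k - y k).valMinAbs.natAbs : ℕ) : ℝ) ≤ (L : ℝ) / 2 := by
      calc (((x k - y k).valMinAbs.natAbs : ℕ) : ℝ) ≤ ((L / 2 : ℕ) : ℝ) := by
            exact_mod_cast ZMod.natAbs_valMinAbs_le (x k - y k)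
        _ ≤ (L : ℝ) / 2 := Nat.cast_div_le
    have h2 : |(((x k - y k).valMinAbs : ℤ) : ℝ)| = (((x k - y k).valMinAbs.natAbs : ℕ) : ℝ) := by
      rw [← Int.cast_abs, Int.abs_eq_natAbs, Int.cast_natCast]
    have h3 : |(((x k - y k).valMinAbs : ℤ) : ℝ)| ≤ (L : ℝ) / 2 := h2 ▸ h1
    calc (((x k - y k).valMinAbs : ℤ) : ℝ) ^ 2 = |(((x k - y k).valMinAbs : ℤ) : ℝ)| ^ 2 :=
          (sq_abs _).symm
      _ ≤ ((L : ℝ) / 2) ^ 2 := pow_le_pow_left₀ (abs_nonneg _) h3 2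
  calc ∑ k : Fin 4, (((x k - y k).valMinAbs : ℤ) : ℝ) ^ 2 ≤ ∑ _k : Fin 4, ((L : ℝ) / 2) ^ 2 :=
        Finset.sum_le_sum fun k _ => hk k
    _ = (L : ℝ) ^ 2 := by simp; ring

/-- **The upper-only variant of the crux HOLDS** (every compact second-countable `G`, continuous
unitary `ρ`): there are `a > 0` with `a → 0` and `β₀` such that on every torus with `β ≥ β₀` and
`L · a(β) ≤ 1`, `n⁸ Cov(P_0^{01}, P_{ne₂}^{01}) ≤ 1` for `1 ≤ n`, `8n ≤ L`, and
`|Cov(P_x^{ij}, P_y^{i'j'})| · dist(x,y)⁸ ≤ 1` for all plaquette pairs — the crux's conclusion with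
`Γ ≡ 1`, `C = 1`, `ℓ₀ = 1` and the lower bound removed. Construction: `T(m)` a threshold beyond
which all plaquette covariances of the torus of side `m+1` are `≤ (m+1)⁻⁸` (freezing), `T'` their
monotone cumulative envelope with `T'(m) ≥ m`, `M(β)` the largest `m ≤ ⌊β⌋` with `T'(m) ≤ β`, and
`a(β) := 1/(M(β)+1)` (`:= 2` before `T'(0)`), so that the femto tori at `β` are exactly those of
side `≤ M(β)+1`. -/
theorem exists_upperOnly [SecondCountableTopology G] (hρ : Continuous ρ)
    (hρu : ∀ g, ρ g ∈ Matrix.unitaryGroup (Fin N) ℂ) :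
    ∃ (a : ℝ → ℝ) (β₀ : ℝ), (∀ β, 0 < a β) ∧ Tendsto a atTop (𝓝 0) ∧
      ∀ (L : ℕ) [NeZero L] (β : ℝ), β₀ ≤ β → (L : ℝ) * a β ≤ 1 →
        (∀ n : ℕ, 1 ≤ n → 8 * n ≤ L →
          (n : ℝ) ^ 8 *
            (wilsonExpectation (d := 4) (L := L) ρ β (fun U =>
                ((N : ℝ) - (ρ (plaquetteHolonomy U (0 : Site 4 L) 0 1)).trace.re) *
                  ((N : ℝ) - (ρ (plaquetteHolonomy U (Pi.single (2 : Fin 4) ((n : ℕ) : ZMod L))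
                    0 1)).trace.re)) -
              wilsonExpectation (d := 4) (L := L) ρ β
                  (fun U => (N : ℝ) - (ρ (plaquetteHolonomy U (0 : Site 4 L) 0 1)).trace.re) *
                wilsonExpectation (d := 4) (L := L) ρ β (fun U => (N : ℝ) -
                  (ρ (plaquetteHolonomy U (Pi.single (2 : Fin 4) ((n : ℕ) : ZMod L)) 0 1)).trace.re))
            ≤ 1) ∧
        ∀ (x y : Site 4 L) (i j i' j' : Fin 4),
          |wilsonExpectation (d := 4) (L := L) ρ β (fun U =>
                ((N : ℝ) - (ρ (plaquetteHolonomy U x i j)).trace.re) *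
                  ((N : ℝ) - (ρ (plaquetteHolonomy U y i' j')).trace.re)) -
              wilsonExpectation (d := 4) (L := L) ρ β
                  (fun U => (N : ℝ) - (ρ (plaquetteHolonomy U x i j)).trace.re) *
                wilsonExpectation (d := 4) (L := L) ρ β
                  (fun U => (N : ℝ) - (ρ (plaquetteHolonomy U y i' j')).trace.re)| *
              Real.sqrt (∑ k : Fin 4, (((x k - y k).valMinAbs : ℤ) : ℝ) ^ 2) ^ 8 ≤ 1 := by
  classical
  -- the covariance functional, as a local abbreviation inside the proof
  let cv : (L : ℕ) → [NeZero L] → ℝ → Site 4 L → Fin 4 → Fin 4 → Site 4 L → Fin 4 → Fin 4 → ℝ :=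
    fun L _ β x i j y i' j' =>
      wilsonExpectation (d := 4) (L := L) ρ β (fun U =>
          ((N : ℝ) - (ρ (plaquetteHolonomy U x i j)).trace.re) *
            ((N : ℝ) - (ρ (plaquetteHolonomy U y i' j')).trace.re)) -
        wilsonExpectation (d := 4) (L := L) ρ β
            (fun U => (N : ℝ) - (ρ (plaquetteHolonomy U x i j)).trace.re) *
          wilsonExpectation (d := 4) (L := L) ρ β
            (fun U => (N : ℝ) - (ρ (plaquetteHolonomy U y i' j')).trace.re)
  -- `good m β`: on the torus of side `m+1` every plaquette covariance is `≤ (m+1)⁻⁸` in size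
  let good : ℕ → ℝ → Prop := fun m β =>
    ∀ t : (Site 4 (m + 1) × Site 4 (m + 1)) × ((Fin 4 × Fin 4) × (Fin 4 × Fin 4)),
      |cv (m + 1) β t.1.1 t.2.1.1 t.2.1.2 t.1.2 t.2.2.1 t.2.2.2| * (((m + 1 : ℕ) : ℝ)) ^ 8 ≤ 1
  have hE : ∀ m, ∀ᶠ β in atTop, good m β := fun m => by
    refine Filter.eventually_all.2 fun t => ?_
    have ht := tendsto_plaquetteCov ρ hρ hρu t.1.1 t.1.2 t.2.1.1 t.2.1.2 t.2.2.1 t.2.2.2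
    have h8 : (0 : ℝ) < (((m + 1 : ℕ) : ℝ)) ^ 8 := by positivity
    filter_upwards [(Metric.tendsto_nhds.1 ht) _ (one_div_pos.2 h8)] with β hβ
    rw [Real.dist_eq, sub_zero, lt_div_iff₀ h8] at hβ
    exact hβ.le
  have hG : ∀ m, ∀ᶠ β in atTop, ∀ m' ∈ Finset.range (m + 1), good m' β := fun m =>
    (Filter.eventually_all_finset _).2 fun m' _ => hE m'
  choose T hT using fun m => Filter.eventually_atTop.1 (hG m)
  -- monotone envelope of the thresholds, `T' m ≥ max (T m) m`
  let T' : ℕ → ℝ := fun m => (∑ k ∈ Finset.range (m + 1), |T k|) + m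
  have hT'T : ∀ m, T m ≤ T' m := fun m => by
    have h1 : |T m| ≤ ∑ k ∈ Finset.range (m + 1), |T k| :=
      Finset.single_le_sum (fun k _ => abs_nonneg (T k)) (Finset.self_mem_range_succ m)
    have h2 := le_abs_self (T m)
    have h3 : (0 : ℝ) ≤ m := Nat.cast_nonneg m
    simp only [T']
    linarith
  have hT'm : ∀ m : ℕ, (m : ℝ) ≤ T' m := fun m => by
    have := Finset.sum_nonneg fun k (_ : k ∈ Finset.range (m + 1)) => abs_nonneg (T k)
    simp only [T']
    linarith
  have hT'mono : ∀ {m m' : ℕ}, m ≤ m' → T' m ≤ T' m' := fun {m m'} hmm' => by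
    simp only [T']
    have h1 : ∑ k ∈ Finset.range (m + 1), |T k| ≤ ∑ k ∈ Finset.range (m' + 1), |T k| :=
      Finset.sum_le_sum_of_subset_of_nonneg (Finset.range_mono (by omega))
        fun k _ _ => abs_nonneg (T k)
    have h2 : (m : ℝ) ≤ m' := by exact_mod_cast hmm'
    linarith
  -- the unit map
  let M : ℝ → ℕ := fun β => Nat.findGreatest (fun m => T' m ≤ β) ⌊β⌋₊
  have hMspec : ∀ β, T' 0 ≤ β → T' (M β) ≤ β := fun β h0 =>
    Nat.findGreatest_spec (P := fun m => T' m ≤ β) (Nat.zero_le _) h0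
  have hMge : ∀ β m, T' m ≤ β → m ≤ M β := fun β m hm =>
    Nat.le_findGreatest (Nat.le_floor ((hT'm m).trans hm)) hm
  let a : ℝ → ℝ := fun β => if T' 0 ≤ β then 1 / ((M β : ℝ) + 1) else 2
  have ha_pos : ∀ β, 0 < a β := fun β => by
    simp only [a]
    split_ifs <;> positivity
  have ha_of : ∀ β, T' 0 ≤ β → a β = 1 / ((M β : ℝ) + 1) := fun β h => by
    simp only [a, if_pos h]
  refine ⟨a, T' 0, ha_pos, ?_, ?_⟩
  · -- `a → 0`
    refine Metric.tendsto_atTop.2 fun ε hε => ?_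
    obtain ⟨m, hm⟩ := exists_nat_one_div_lt hε
    refine ⟨T' m, fun β hβ => ?_⟩
    have h0 : T' 0 ≤ β := (hT'mono (Nat.zero_le m)).trans hβ
    rw [Real.dist_eq, sub_zero, abs_of_pos (ha_pos β), ha_of β h0]
    have hmM : (m : ℝ) + 1 ≤ (M β : ℝ) + 1 := by exact_mod_cast Nat.succ_le_succ (hMge β m hβ)
    calc 1 / ((M β : ℝ) + 1) ≤ 1 / ((m : ℝ) + 1) :=
          one_div_le_one_div_of_le (by positivity) hmM
      _ < ε := hm
  · -- the clauses on a femto torus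
    intro L _ β hβ0 hLa
    obtain ⟨m', rfl⟩ : ∃ m', L = m' + 1 := ⟨L - 1, (Nat.succ_pred_eq_of_ne_zero (NeZero.ne L)).symm⟩
    rw [ha_of β hβ0] at hLa
    have hLM : m' + 1 ≤ M β + 1 := by
      have h1 : ((m' + 1 : ℕ) : ℝ) ≤ (M β : ℝ) + 1 := by
        have hpos : (0 : ℝ) < (M β : ℝ) + 1 := by positivity
        have := hLa
        rw [mul_one_div, div_le_one hpos] at this
        exact this
      exact_mod_cast h1
    have hgood : good m' β := by
      refine hT (M β) β ((hT'T _).trans (hMspec β hβ0)) m' ?_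
      exact Finset.mem_range.2 (by omega)
    refine ⟨fun n hn hnL => ?_, fun x y i j i' j' => ?_⟩
    · have hg := hgood (((0 : Site 4 (m' + 1)), Pi.single (2 : Fin 4) ((n : ℕ) : ZMod (m' + 1))),
        (((0 : Fin 4), (1 : Fin 4)), ((0 : Fin 4), (1 : Fin 4))))
      have hn8 : (n : ℝ) ^ 8 ≤ (((m' + 1 : ℕ) : ℝ)) ^ 8 :=
        pow_le_pow_left₀ (Nat.cast_nonneg n) (by exact_mod_cast (by omega : n ≤ m' + 1)) 8
      change (n : ℝ) ^ 8 * cv (m' + 1) β 0 0 1 (Pi.single (2 : Fin 4) ((n : ℕ) : ZMod (m' + 1)))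
        0 1 ≤ 1
      calc (n : ℝ) ^ 8 * cv (m' + 1) β 0 0 1 (Pi.single (2 : Fin 4) ((n : ℕ) : ZMod (m' + 1))) 0 1
            ≤ (n : ℝ) ^ 8 *
              |cv (m' + 1) β 0 0 1 (Pi.single (2 : Fin 4) ((n : ℕ) : ZMod (m' + 1))) 0 1| :=
            mul_le_mul_of_nonneg_left (le_abs_self _) (by positivity)
        _ ≤ (((m' + 1 : ℕ) : ℝ)) ^ 8 *
              |cv (m' + 1) β 0 0 1 (Pi.single (2 : Fin 4) ((n : ℕ) : ZMod (m' + 1))) 0 1| :=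
            mul_le_mul_of_nonneg_right hn8 (abs_nonneg _)
        _ ≤ 1 := by rw [mul_comm]; exact hg
    · have hg := hgood ((x, y), ((i, j), (i', j')))
      have hd8 : Real.sqrt (∑ k : Fin 4, (((x k - y k).valMinAbs : ℤ) : ℝ) ^ 2) ^ 8 ≤
          (((m' + 1 : ℕ) : ℝ)) ^ 8 :=
        pow_le_pow_left₀ (Real.sqrt_nonneg _) (torusDist_le_side x y) 8
      change |cv (m' + 1) β x i j y i' j'| *
          Real.sqrt (∑ k : Fin 4, (((x k - y k).valMinAbs : ℤ) : ℝ) ^ 2) ^ 8 ≤ 1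
      calc |cv (m' + 1) β x i j y i' j'| *
            Real.sqrt (∑ k : Fin 4, (((x k - y k).valMinAbs : ℤ) : ℝ) ^ 2) ^ 8
            ≤ |cv (m' + 1) β x i j y i' j'| * (((m' + 1 : ℕ) : ℝ)) ^ 8 :=
            mul_le_mul_of_nonneg_left hd8 (abs_nonneg _)
        _ ≤ 1 := hg

omit [MeasurableSpace G] [BorelSpace G] in
/-- The faithful-representation form, with the crux's own Borel σ-algebra and second countability
supplied by the representation. -/
theorem exists_upperOnly_rep (r : LatticeRep G) :
    letI : MeasurableSpace G := borel G
    haveI : BorelSpace G := ⟨rfl⟩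
    ∃ (a : ℝ → ℝ) (β₀ : ℝ), (∀ β, 0 < a β) ∧ Tendsto a atTop (𝓝 0) ∧
      ∀ (L : ℕ) [NeZero L] (β : ℝ), β₀ ≤ β → (L : ℝ) * a β ≤ 1 →
        (∀ n : ℕ, 1 ≤ n → 8 * n ≤ L →
          (n : ℝ) ^ 8 *
            (wilsonExpectation (d := 4) (L := L) r.ρ β (fun U =>
                ((r.N : ℝ) - (r.ρ (plaquetteHolonomy U (0 : Site 4 L) 0 1)).trace.re) *
                  ((r.N : ℝ) - (r.ρ (plaquetteHolonomy U (Pi.single (2 : Fin 4)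
                    ((n : ℕ) : ZMod L)) 0 1)).trace.re)) -
              wilsonExpectation (d := 4) (L := L) r.ρ β
                  (fun U => (r.N : ℝ) - (r.ρ (plaquetteHolonomy U (0 : Site 4 L) 0 1)).trace.re) *
                wilsonExpectation (d := 4) (L := L) r.ρ β (fun U => (r.N : ℝ) -
                  (r.ρ (plaquetteHolonomy U (Pi.single (2 : Fin 4) ((n : ℕ) : ZMod L))
                    0 1)).trace.re))
            ≤ 1) ∧
        ∀ (x y : Site 4 L) (i j i' j' : Fin 4),
          |wilsonExpectation (d := 4) (L := L) r.ρ β (fun U =>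
                ((r.N : ℝ) - (r.ρ (plaquetteHolonomy U x i j)).trace.re) *
                  ((r.N : ℝ) - (r.ρ (plaquetteHolonomy U y i' j')).trace.re)) -
              wilsonExpectation (d := 4) (L := L) r.ρ β
                  (fun U => (r.N : ℝ) - (r.ρ (plaquetteHolonomy U x i j)).trace.re) *
                wilsonExpectation (d := 4) (L := L) r.ρ β
                  (fun U => (r.N : ℝ) - (r.ρ (plaquetteHolonomy U y i' j')).trace.re)| *
              Real.sqrt (∑ k : Fin 4, (((x k - y k).valMinAbs : ℤ) : ℝ) ^ 2) ^ 8 ≤ 1 := by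
  letI : MeasurableSpace G := borel G
  haveI : BorelSpace G := ⟨rfl⟩
  haveI : SecondCountableTopology G := secondCountable_of_latticeRep r
  exact exists_upperOnly r.ρ r.continuous r.mem_unitary

end Summit.QuantumFields.YangMills.Theorems.FemtoCurvatureTwoPoint.Negative.UpperOnly

end
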